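import Mathlib.RingTheory.LocalRing.Module
import Mathlib.RingTheory.LocalRing.ResidueField.Basic
import Mathlib.LinearAlgebra.TensorProduct.Tower
import Mathlib.LinearAlgebra.Dimension.Constructions
import Mathlib.LinearAlgebra.Dimension.Free
import HarnessLib

/-!
# Ring 2 / AbelianAll — the rank of a finite module over a local ring can only drop at the generic point (WEIL-2 gen 63, PROPOSITION S)

research route, not a corollary; conditional on HC_CM plus one named minimal statement.
`HC_CM` occurs nowhere in this file; nothing here is a case of the Hodge conjecture.

Fact-free commutative-algebra core of PROPOSITION S of the account `FIBRE-G63.md` (pub-hodge-ring2,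
seat ab-weil-2, gen 63): the degree `δ̄` of Schoen's packet map `Q → Ẑ` is UPPER semicontinuous under
specialisation, because for the finite torsion-free module `M = (Ψ_*O_Q)_ξ` over the local ring of the
image at the generic point `ξ` of the special image, the generic rank (`= δ̄` of the general member) is at
most the number of generators, which is the fibre dimension over the residue field (`= δ̄` of the
special member).  The lemma below is that inequality in the form: for a local ring `R` with residue
field `k`, a finite `R`-module `M` and ANY `R`-algebra `L` that is a field,
`dim_L (L ⊗_R M) ≤ dim_k (k ⊗_R M)` — Nakayama (`IsLocalRing.span_eq_top_of_tmul_eq_basis`) plus base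
change of a spanning family.
-/

namespace Summit.HodgeConjecture.Ring2AbelianAll.GeneratorRank

open Module IsLocalRing TensorProduct

/-- PROPOSITION S (algebraic core).  `R` local with residue field `k`, `M` a finite `R`-module, `L` a
field which is an `R`-algebra (e.g. the fraction field of a local domain): `finrank_L (L ⊗ M) ≤
finrank_k (k ⊗ M)`.  Proof: a `k`-basis of `k ⊗ M` lifts to generators of `M` (Nakayama), whose images
span `L ⊗ M` over `L`. -/
theorem finrank_baseChange_le_finrank_residueField
    {R : Type*} [CommRing R] [IsLocalRing R] {M : Type*} [AddCommGroup M] [Module R M]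
    [Module.Finite R M] (L : Type*) [Field L] [Algebra R L] :
    finrank L (L ⊗[R] M) ≤ finrank (ResidueField R) ((ResidueField R) ⊗[R] M) := by
  classical
  let b := Module.finBasis (ResidueField R) ((ResidueField R) ⊗[R] M)
  -- every element of k ⊗ M is of the form 1 ⊗ m
  have hsurj : ∀ x : (ResidueField R) ⊗[R] M, ∃ m : M, (1 : ResidueField R) ⊗ₜ[R] m = x := by
    intro x
    have htop : (⊤ : Submodule R M).map (TensorProduct.mk R (ResidueField R) M 1) = ⊤ :=
      (IsLocalRing.map_tensorProduct_mk_eq_top (N := (⊤ : Submodule R M))).2 rfl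
    have hx : x ∈ (⊤ : Submodule R M).map (TensorProduct.mk R (ResidueField R) M 1) := by
      rw [htop]; exact Submodule.mem_top
    obtain ⟨m, -, hm⟩ := hx
    exact ⟨m, hm⟩
  choose f hf using fun i => hsurj (b i)
  -- Nakayama: the lifts generate M
  have hspan : Submodule.span R (Set.range f) = ⊤ :=
    IsLocalRing.span_eq_top_of_tmul_eq_basis f b hf
  -- base change to L: their images span L ⊗ M over L
  have hL : Submodule.span L (Set.range fun i => (TensorProduct.mk R L M 1) (f i)) = ⊤ := by
    change Submodule.span L (Set.range ((TensorProduct.mk R L M 1) ∘ f)) = ⊤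
    rw [Set.range_comp, ← Submodule.baseChange_span, hspan, Submodule.baseChange_top]
  calc finrank L (L ⊗[R] M)
      ≤ Fintype.card (Fin (finrank (ResidueField R) ((ResidueField R) ⊗[R] M))) :=
        finrank_le_of_span_eq_top hL
    _ = finrank (ResidueField R) ((ResidueField R) ⊗[R] M) := Fintype.card_fin _

end Summit.HodgeConjecture.Ring2AbelianAll.GeneratorRank
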